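import Mathlib
import Literature.Analysis.FluidPDE.Tao2016AveragedNS.LocalCascadeSolutions
import Literature.Analysis.FluidPDE.Tao2016AveragedNS.RenormalisedCascadeWaves
import HarnessLib

/-!
# The ROTOR CIRCUIT table `rotorTable ∈ E₂(4)` — a three-mode member of Tao's comparable class whose blow-up front
# is numerically (S₁)-surviving at moderate `ε₀` (route `TaoLadderRungTwoBreak`, cruxes ⟨20419⟩ / ⟨20205⟩: instrument object)

D-0017 `<RouteSlug>Defs`: an OBJECT posited for the cruxes `NoSurvivingEternalViscBddOne` (stmt-NavierStokesRegularity-20419) and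
`NoSurvivingDSSOne` (stmt-…-20205) of route TaoLadderRungTwoBreak — an explicit table on which the K1-type Liouville predicates
(`NoSurvivingEternalBdd 4 1`, `NoSurvivingDSS 4 1`, WakeRatchet's rate ratchets) can be TESTED shell by shell, and on which this hand's
numerics (evidence `NUMERICS-20419-wake-exponent-leafhand4-g0.md` v6 on both items: Dormand–Prince integration of Tao's (4.8) from a
one-shell datum) find the blow-up-selected period-1 DSS front to be forward (S₁)-SURVIVING for `ε₀ ∈ [0.08, 0.4]` (wake exponent
`a_w = 0.80–0.99 < 1`, e.g. `μ = 0.865 > (1.2)^{-1}` at `ε₀ = 0.2`) and NOT surviving for `ε₀ ≤ 0.07` (`a_w = 1.05–1.15`), whereas the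
dyadic member never survives (`a_w ≥ 1.207`).  So every K1-type item lives only through its `∃ εs` binder (`εs(4) ≤ 0.07` numerically);
a CERTIFIED surviving DSS wave of `rotorTable` at `ε₀ = 1/5` is the natural Negative-lemma target («`NoSurvivingDSS 4 1 ⟹ εs < 1/5`»).

The table (modes `u = 0`, `v = 1`, `w = 2`; mode `3` idle), written as Tao gates [Tao2016AveragedNS §5]:
* forward coupling `u_{n-1}² → v_n`:  `α_{uuv,(0,0,1)} = 1`, back-reaction `α_{vuu,(1,0,0)} = α_{uvu,(0,1,0)} = −1/2`;
* trigger pump `v → w` (strength 1/2):  `α_{vvw,(0,0,0)} = 1/2`, `α_{vwv} = α_{wvv} = −1/4`;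
* ROTOR `v → u` driven by `w`:  `(Q x)_u = x_v x_w`, `(Q x)_v = −x_u x_w`:  `α_{vwu} = α_{wvu} = 1/2`, `α_{uwv} = α_{wuv} = −1/2`;
* drain pump `w → u`:  `α_{wwu,(0,0,0)} = 1`, `α_{wuw} = α_{uww} = −1/2`.
In Tao's normal form: `u̇_n = Λⁿ(v_n w_n + w_n² − v_{n+1} u_n)`, `v̇_n = Λ^{n−1} u_{n−1}² − Λⁿ(½ v_n w_n + u_n w_n)`,
`ẇ_n = Λⁿ(½ v_n² − w_n u_n)` (`Λ = (1+ε₀)^{5/2}`).  It is symmetric (4.2), cancelling (4.3) and `4`-comparable (entries in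
`{0, 1, ±1/2, −1/4}`), i.e. `InTableClass R rotorTable` for every `R ≥ 4` — all PROVED below by finite case analysis.  It is NOT a
strong-orthant (Kamke) table (the rotor term `−x_u x_w` in `(Q x)_v` is not proportional to `x_v`).
MODEL lattice ODEs of Tao 2016 §4 only; nothing here is a statement about the Navier–Stokes equations; DEFINITIONS plus membership
lemmas; nothing is claimed about solutions of this table in this file (the survival findings above are numerical evidence, not theorems).
-/

noncomputable section

-- the sub-problem namespace repeats the summit name by design (D-0017)
set_option linter.dupNamespace false

namespace Summit.NavierStokesRegularity.NavierStokesRegularity.Theorems.TaoLadderRungTwoBreakRotor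

open Literature.Analysis.FluidPDE Literature.Analysis.FluidPDE.TaoCascade

/-- The in-shell gate block (shift `(0,0,0)`) of the rotor circuit: trigger pump `v → w` (1/2), rotor `v → u` driven by `w`, drain pump
`w → u`; indices `(i₁, i₂, i₃)` = (first factor, second factor, driven mode), modes `u = 0, v = 1, w = 2`.
[cite: Tao2016AveragedNS, §4 (4.1)–(4.3) and §5 (pump / rotor gates); cell vocabulary (this hand's instrument table)] -/
def rotorGate (i₁ i₂ i₃ : Fin 4) : ℝ :=
  if i₁ = 1 ∧ i₂ = 1 ∧ i₃ = 2 then 1 / 2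
  else if (i₁ = 1 ∧ i₂ = 2 ∧ i₃ = 1) ∨ (i₁ = 2 ∧ i₂ = 1 ∧ i₃ = 1) then -(1 / 4)
  else if (i₁ = 1 ∧ i₂ = 2 ∧ i₃ = 0) ∨ (i₁ = 2 ∧ i₂ = 1 ∧ i₃ = 0) then 1 / 2
  else if (i₁ = 0 ∧ i₂ = 2 ∧ i₃ = 1) ∨ (i₁ = 2 ∧ i₂ = 0 ∧ i₃ = 1) then -(1 / 2)
  else if i₁ = 2 ∧ i₂ = 2 ∧ i₃ = 0 then 1
  else if (i₁ = 2 ∧ i₂ = 0 ∧ i₃ = 2) ∨ (i₁ = 0 ∧ i₂ = 2 ∧ i₃ = 2) then -(1 / 2)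
  else 0

/-- **The rotor circuit table** `rotorTable : Fin 4 → Fin 4 → Fin 4 → ℤ³ → ℝ` (zero off Tao's shift set): forward coupling
`u_{n-1}² → v_n` with its cancelling back-reaction, and the in-shell gate block `rotorGate`.
[cite: Tao2016AveragedNS, §4 (4.1)–(4.3), §5; cell vocabulary (this hand's instrument table)] -/
def rotorTable : Fin 4 → Fin 4 → Fin 4 → ℤ × ℤ × ℤ → ℝ := fun i₁ i₂ i₃ μ =>
  if μ = ((0 : ℤ), (0 : ℤ), (1 : ℤ)) then (if i₁ = 0 ∧ i₂ = 0 ∧ i₃ = 1 then 1 else 0)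
  else if μ = ((1 : ℤ), (0 : ℤ), (0 : ℤ)) then (if i₁ = 1 ∧ i₂ = 0 ∧ i₃ = 0 then -(1 / 2) else 0)
  else if μ = ((0 : ℤ), (1 : ℤ), (0 : ℤ)) then (if i₁ = 0 ∧ i₂ = 1 ∧ i₃ = 0 then -(1 / 2) else 0)
  else if μ = ((0 : ℤ), (0 : ℤ), (0 : ℤ)) then rotorGate i₁ i₂ i₃
  else 0

/-- Symmetry (4.2) of the rotor circuit table. [cite: Tao2016AveragedNS, §4 (4.2)] -/
theorem rotorTable_symmetric : IsSymmetricCoeff rotorTable := by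
  intro i₁ i₂ i₃ μ₁ μ₂ μ₃ hμ
  rw [mem_shiftSet_iff] at hμ
  simp only [Prod.mk.injEq] at hμ
  rcases hμ with ⟨rfl, rfl, rfl⟩ | ⟨rfl, rfl, rfl⟩ | ⟨rfl, rfl, rfl⟩ | ⟨rfl, rfl, rfl⟩ <;>
    fin_cases i₁ <;> fin_cases i₂ <;> fin_cases i₃ <;> simp [rotorTable, rotorGate]

/-- Cancellation (4.3) of the rotor circuit table (every gate conserves the shell energy; the forward coupling is cancelled by its
back-reaction). [cite: Tao2016AveragedNS, §4 (4.3)] -/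
theorem rotorTable_cancelling : IsCancellingCoeff rotorTable := by
  intro i₁ i₂ i₃ μ₁ μ₂ μ₃ hμ
  rw [mem_shiftSet_iff] at hμ
  simp only [Prod.mk.injEq] at hμ
  rcases hμ with ⟨rfl, rfl, rfl⟩ | ⟨rfl, rfl, rfl⟩ | ⟨rfl, rfl, rfl⟩ | ⟨rfl, rfl, rfl⟩ <;>
    fin_cases i₁ <;> fin_cases i₂ <;> fin_cases i₃ <;> simp [rotorTable, rotorGate] <;> norm_num

/-- The gate block takes only the values `0, 1, 1/2, −1/2, −1/4`. [cite: Tao2016AveragedNS, §4 (4.1); cell vocabulary] -/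
theorem rotorGate_values (i₁ i₂ i₃ : Fin 4) :
    rotorGate i₁ i₂ i₃ = 0 ∨ rotorGate i₁ i₂ i₃ = 1 ∨ rotorGate i₁ i₂ i₃ = 1 / 2 ∨
      rotorGate i₁ i₂ i₃ = -(1 / 2) ∨ rotorGate i₁ i₂ i₃ = -(1 / 4) := by
  unfold rotorGate
  split_ifs <;> simp

/-- The table takes only the values `0, 1, 1/2, −1/2, −1/4`. [cite: Tao2016AveragedNS, §4 (4.1); cell vocabulary] -/
theorem rotorTable_values (i₁ i₂ i₃ : Fin 4) (μ : ℤ × ℤ × ℤ) :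
    rotorTable i₁ i₂ i₃ μ = 0 ∨ rotorTable i₁ i₂ i₃ μ = 1 ∨ rotorTable i₁ i₂ i₃ μ = 1 / 2 ∨
      rotorTable i₁ i₂ i₃ μ = -(1 / 2) ∨ rotorTable i₁ i₂ i₃ μ = -(1 / 4) := by
  unfold rotorTable
  split_ifs <;> first | exact rotorGate_values i₁ i₂ i₃ | simp

/-- `R`-comparability of the rotor circuit table for every spread `R ≥ 4` (the smallest non-zero modulus is `1/4`, from the trigger pump).
[cite: Tao2016AveragedNS, §6.1; cell vocabulary] -/
theorem rotorTable_comparable {R : ℝ} (hR : 4 ≤ R) : IsComparableCoeff R rotorTable := by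
  intro i₁ i₂ i₃ μ _
  have hRpos : 0 < R := by linarith
  have hq : R⁻¹ ≤ 1 / 4 := by
    rw [inv_le_comm₀ hRpos (by norm_num)]; norm_num; exact hR
  rcases rotorTable_values i₁ i₂ i₃ μ with h | h | h | h | h <;> rw [h]
  · simp
  · refine ⟨by simp, Or.inr ?_⟩
    simp only [abs_one]; linarith
  · refine ⟨by norm_num, Or.inr ?_⟩
    rw [abs_of_pos (by norm_num : (0:ℝ) < 1 / 2)]; linarith
  · refine ⟨by norm_num, Or.inr ?_⟩
    rw [abs_neg, abs_of_pos (by norm_num : (0:ℝ) < 1 / 2)]; linarith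
  · refine ⟨by norm_num, Or.inr ?_⟩
    rw [abs_neg, abs_of_pos (by norm_num : (0:ℝ) < 1 / 4)]; exact hq

/-- **The rotor circuit is a member of E₂(R) for every `R ≥ 4`.** [cite: Tao2016AveragedNS, §4 (4.2)–(4.3), §6.1; cell vocabulary] -/
theorem inTableClass_rotorTable {R : ℝ} (hR : 4 ≤ R) : InTableClass R rotorTable :=
  ⟨rotorTable_symmetric, rotorTable_cancelling, rotorTable_comparable hR⟩

end Summit.NavierStokesRegularity.NavierStokesRegularity.Theorems.TaoLadderRungTwoBreakRotor

end
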